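import Mathlib
import HarnessLib
import Summits.FinalStateConjecture.FinalStateConjecture.Statement

/-!
# Crux `RecurrentlyFlatDisperses` (stmt-FinalStateConjecture-14665), line `Sketch`
# (card `outgoing-blind-cup-restart`) — registered stub `stub_anchorCone`

The C⁰ anchor of the crux hypothesis (`deviationCk (Minkowski.backgroundOn U₀) Ψ₀ 0 τ ≤ 1/4` for every
`τ > τ₀`) unpacked pointwise: at every point of the late region `{x⁰ > τ₀} ⊆ U₀` the deviation
`Ψ₀^* g − η : E4 →L[ℝ] E4 →L[ℝ] ℝ` has operator norm `≤ 1/4` (the `m = 0` term of the `C⁰` sup norm on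
the slab through the point). Mathlib + the Statement cone only; no definitions.
-/

noncomputable section

open scoped Manifold ContDiff Topology
open Filter Set TopologicalSpace Literature.Geometry.Lorentzian

namespace Summit.FinalStateConjecture.FinalStateConjecture.Theorems.RecurrentlyFlatDisperses

/-- **Anchor, unpacked** (registered stub `stub_anchorCone` of crux stmt-FinalStateConjecture-14665, the
skeleton's `AnchorCone` unfolded): under the crux's anchored hypothesis the deviation `Ψ₀^* g − η` has
operator norm at most `1/4` at every point of the late region `{x⁰ > τ₀}`. -/
theorem stub_anchorCone :
    ∀ (X : Type) [TopologicalSpace X] [ChartedSpace E3 X] [IsManifold (𝓡 3) ∞ X] [T2Space X]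
      [SecondCountableTopology X] [ConnectedSpace X],
      ∀ D ∈ admissibleVacuumData X, ∀ 𝒟 : VacuumCauchyDevelopment D, 𝒟.IsMaximal →
        ∀ (O : Set 𝒟.carrier) (τ₀ : ℝ) (U₀ : Opens E4) (Ψ₀ : U₀ → 𝒟.carrier),
          (𝒟.toSpacetime.IsLateChart (Minkowski.backgroundOn U₀) O τ₀ Ψ₀ ∧
            {x : E4 | τ₀ < x 0} ⊆ (U₀ : Set E4) ∧
            O = Summit.FinalStateConjecture.exteriorOf 𝒟.toCauchyDevelopment
              (Ψ₀ '' (Minkowski.backgroundOn U₀).lateRegion τ₀) ∧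
            (∀ τ₁ : ℝ, τ₀ < τ₁ → O \ Ψ₀ '' (Minkowski.backgroundOn U₀).lateRegion τ₁ ⊆
              𝒟.metric.causalPast 𝒟.timeOrientation
                (Ψ₀ '' (Minkowski.backgroundOn U₀).timeSlab τ₁)) ∧
            (∀ τ : ℝ, τ₀ < τ → 𝒟.toSpacetime.deviationCk (Minkowski.backgroundOn U₀) Ψ₀ 0 τ ≤
              ENNReal.ofReal (1 / 4))) →
          (∀ x : U₀, τ₀ < x.1 0 →
            ‖𝒟.toSpacetime.deviation (Minkowski.backgroundOn U₀) Ψ₀ x‖ ≤ 1 / 4) := by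
  intro X _ _ _ _ _ _ D _ 𝒟 _ O τ₀ U₀ Ψ₀ h x hx
  obtain ⟨-, -, -, -, hC0⟩ := h
  -- the `C⁰` anchor on the slab `{x⁰ = x.1 0}` through `x`
  have hτ : supCkENorm (Subtype.val '' (Minkowski.backgroundOn U₀).timeSlab (x.1 0)) 0
      (𝒟.toSpacetime.deviationExtend (Minkowski.backgroundOn U₀) Ψ₀) ≤ ENNReal.ofReal (1 / 4) :=
    hC0 (x.1 0) hx
  -- `x` lies on that slab (`B.time x.1 = x.1 0` definitionally for the Minkowski background)
  have hmem : x ∈ (Minkowski.backgroundOn U₀).timeSlab (x.1 0) := rfl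
  have h' := (enorm_iteratedFDeriv_le_supCkENorm (le_refl 0) (mem_image_of_mem Subtype.val hmem)
    (𝒟.toSpacetime.deviationExtend (Minkowski.backgroundOn U₀) Ψ₀)).trans hτ
  rw [← ofReal_norm, ENNReal.ofReal_le_ofReal_iff (by norm_num), norm_iteratedFDeriv_zero,
    Spacetime.deviationExtend_coe] at h'
  exact h'

end Summit.FinalStateConjecture.FinalStateConjecture.Theorems.RecurrentlyFlatDisperses

end
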